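import Summits.QuantumFields.BalabanUV.T4Continuum.Support.ScalarAveragedCompression
import Literature.MathematicalPhysics.QuantumFieldTheory.Balaban1983to89.B5Value126

/-!
# T⁴ programme, spine node NE2 (U1a), tier B support row B4.c, file 5 — AT `U = 1` THE RESOLVENT PROJECTION OF [B9] (3.25) IS
# B5's (1.70) PLUS THE CONSTANTS: `G′Q′ᴴ(Q′G′²Q′ᴴ)⁻¹Q′G′ = PcT + Pker`, hence `∂·P₁·∂ᴴ = ∂·PcT·∂ᴴ` — the `U = 1` value of the
# factorised gauge term of tier B IS the `−∂P∂*` term of `calDa = Δ_a` (1.69)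

NE2 formalisation swarm `b2b-balaban-t4-ne2-formalise-*`, leaf 09 (support row B4.c).  Tier-B row B4 types the gauge summand of
[Balaban1985BackgroundPropagators] (3.26) p.395 «Δ_a = Δ + DRD* + Q*aQ» through (3.25) p.394 «R = I − G′Q′*(Q′G′²Q′*)⁻¹Q′G′»,
`G′ = (Δ′_a)⁻¹`, `Δ′_a = Δ_U + Q′*aQ′` (3.24), as the factorised family `Z(U)ᴴN(U)Z(U)`, and SUBTRACTS its `U = 1` value as DATA
(`Spine/NE2BalabanLayer`: `sandwichPert Z₁ Z₀ N₁ N₀`; skeleton dictionary B0, trigger c5).  The free operator of the route is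
`calDa = Δ − ∂·PcT·∂ᴴ + a•Q*Q` (`B5DeltaA169.calDa_eq_DeltaA`), with B5's (1.26)/(1.70) projection `PcT = Δ⁻¹Q′ᴴ(Q′Δ⁻²Q′ᴴ)⁻¹Q′Δ⁻¹`
(`B5Value126.PcT`, `Δ⁻¹ = LapSinv` vanishing on constants).  This file CERTIFIES, for the typed `U = 1` objects, the sentence that
makes the two match (leaf-05's interface note, CLAIMS.log 2026-08-20 l.5510 (1): «at U = 1 this P is … B5's (1.70) PcT — the two
resolvents give the SAME projection»):

 * §1 tools: `ext_of_mulVec_rect`, the mean formula `Pker f = |T_η|⁻¹(Σf)·1` (`Pker_mulVec_eq`), `Pker·Q′ᴴ = Q′ᴴ·Cavg`, the constants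
   under `Δ′ = DeltaPs`, `G′ = Gps`, `Π′`: `Δ′1 = a′1`, `G′1 = a′⁻¹1`;
 * §2 **`Pone n M a′ := G′·Q′ᴴ·(Q′G′G′Q′ᴴ)⁻¹·Q′·G′`** (the `U = 1` value of 1 − R of (3.25); scale-invariant in `Q′`:
   `Pone_eq_iso : Pone = G′·Q̃′ᴴ·Kcomp⁻¹·Q̃′·G′` with file 3b's isometric `Q̃′`, `Kcomp`), `isUnit_det_Kone`, `Pone_isHermitian`,
   `Pone_mul_GQ : Pone·(G′Q′ᴴ) = G′Q′ᴴ`, the resolvent exchange **`LapSinv_QsOpH_eq`**: `Δ⁻¹Q′ᴴ = G′Q′ᴴ·(1 − Cavg + a′n^d·Q′Δ⁻¹Q′ᴴ)`,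
   hence `Pone·PcT = PcT`, and `Pone·Pker = Pker` (`Pone 1 = 1`);
 * §3 the converse inclusion **`T_mul_GQ_eq_zero`**: `(1 − PcT − Pker)·G′Q′ᴴ = 0` (for `w = (1 − PcT − Pker)G′Q′ᴴω`: `λ = Δ⁻¹w` has
   `Q′λ = 0`, `Δλ = w`, so `‖w‖² = ⟨G′Q′ᴴω, Δλ⟩ = ⟨Q′ᴴω, G′(Δ′ − a′Π′)λ⟩ = ⟨ω, Q′λ⟩ = 0`), whence **`Pone_eq : Pone = PcT + Pker`**
   and **`GradOp_Pone_GradOpH_eq : ∂·Pone·∂ᴴ = ∂·PcT·∂ᴴ`** (`∂·Pker = 0`): the typed `U = 1` gauge term of tier B equals the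
   `∂P∂*` term of `DeltaA`/`calDa` — a kernel fact replacing that part of the B0 reading at `U = 1`.

HONEST FRAMING (T4-DAG p. 1).  [folklore] finite-dimensional linear algebra about the cell's typed `U = 1` objects (b05's `PcT`,
`LapSinv`, `Pker`, `QsOp`; row B4.c's `DeltaPs`, `Gps`); statements OURS; nothing printed is a hypothesis; NOT an assertion of B0 for
`U ≠ 1` or for the other summands.  `U = 1`, FIXED FINITE torus, scalar layer; NE2 NOT proved; spine 0/9 unchanged; NOT infinite
volume / mass gap / Clay / summit progress.  HONEST DEPENDENCY: continuum YM on T⁴ ⇐ BetaPertH ∧ nine spine estimates (0/9 proved);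
BetaPertH ⇐ (D1) ∧ (D4) ∧ CAP+tail; G-an2-4 gates asym, D1 and NE2/3/4.  ABSOLUTE RULE kept; zero sorries.
-/

noncomputable section

open scoped BigOperators ComplexConjugate ComplexOrder Matrix Matrix.Norms.L2Operator
open Finset

namespace Summit.QuantumFields.BalabanUV.T4Continuum.ScalarGaugeProjectionUnit

open Literature.MathematicalPhysics.QuantumFieldTheory.Balaban1983to89.B5Prop11Plancherel
open Literature.MathematicalPhysics.QuantumFieldTheory.Balaban1983to89.B5Prop11Lower (nsq nsq_nonneg star_dotProduct_self)
open Literature.MathematicalPhysics.QuantumFieldTheory.Balaban1983to89.B5Action121 (sdiff LapS GradOp GradOp_mulVec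
  star_mulVec_dotProduct)
open Literature.MathematicalPhysics.QuantumFieldTheory.Balaban1983to89.B5Block118 (QsOp)
open Literature.MathematicalPhysics.QuantumFieldTheory.Balaban1983to89.B5Blocks16 (blockOf sum_QsOp)
open Literature.MathematicalPhysics.QuantumFieldTheory.Balaban1983to89.B5LaplaceSpectral (sdiff_const LapS_const)
open Literature.MathematicalPhysics.QuantumFieldTheory.Balaban1983to89.B5LaplaceInverse (LapSinv Pker LapS_mul_LapSinv
  LapSinv_mul_LapS LapSinv_mul_Pker Pker_mul_LapSinv Pker_mul_Pker Pker_conjTranspose Pker_orth sum_LapSinv LapSinv_conjTranspose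
  LapS_LapSinv_of_orth)
open Literature.MathematicalPhysics.QuantumFieldTheory.Balaban1983to89.B5Projection127 (Pc)
open Literature.MathematicalPhysics.QuantumFieldTheory.Balaban1983to89.B5Substitution125 (QsOp_const QsOp_adjoint_const
  sum_QsOp_adjoint Mop Mop_mulVec Cavg Cavg_mulVec Minv Mop_Minv_of_orth)
open Literature.MathematicalPhysics.QuantumFieldTheory.Balaban1983to89.B5Value126 (PcT PcT_mul_PcT PcT_conjTranspose ext_of_mulVec
  sum_QsOp_LapSinv)
open Literature.MathematicalPhysics.QuantumFieldTheory.Balaban1983to89.B5Adjoint130 (QsOp_adjoint_mulVec)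
open Summit.QuantumFields.BalabanUV.T4Continuum.ScalarBlockPoincare
open Summit.QuantumFields.BalabanUV.T4Continuum.ScalarAveragedPropagator
open Summit.QuantumFields.BalabanUV.T4Continuum.ScalarAveragedCompression

variable {d : ℕ}

/-! ## §1 Tools: rectangular extensionality, the mean formula for `Pker`, constants under `Δ′`, `G′` -/

section Tools

variable (n : ℕ) [NeZero n] (M : Fin d → ℕ) [hM : ∀ μ, NeZero (M μ)] (a' : ℝ)

omit hM in
/-- rectangular matrices agreeing on every vector are equal. [folklore] -/
theorem ext_of_mulVec_rect {m k : Type*} [Fintype m] [DecidableEq m] [Fintype k] [DecidableEq k] {A B : Matrix m k ℂ}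
    (h : ∀ v, A *ᵥ v = B *ᵥ v) : A = B :=
  Matrix.toLin'.injective (LinearMap.ext fun v => by rw [Matrix.toLin'_apply, Matrix.toLin'_apply, h v])

/-- `Pker 1 = 1` (`Δ⁻¹Δ = 1 − Pker` applied to a constant). [folklore] -/
theorem Pker_mulVec_const (a : ℂ) : Pker (fine n M) (n : ℂ) *ᵥ (fun _ : Tor (fine n M) => a) = fun _ => a := by
  have h1 : (LapSinv (fine n M) (n : ℂ) * LapS (fine n M) (n : ℂ)) *ᵥ (fun _ : Tor (fine n M) => a)
      = (1 - Pker (fine n M) (n : ℂ)) *ᵥ (fun _ : Tor (fine n M) => a) := by rw [LapSinv_mul_LapS]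
  rw [← Matrix.mulVec_mulVec, LapS_const, Matrix.mulVec_zero, Matrix.sub_mulVec, Matrix.one_mulVec] at h1
  exact (sub_eq_zero.mp h1.symm).symm

/-- **the mean formula** `Pker f = |T_η|⁻¹·(Σ_x f x)·1`. [folklore] -/
theorem Pker_mulVec_eq (f : Tor (fine n M) → ℂ) :
    Pker (fine n M) (n : ℂ) *ᵥ f = fun _ => (Fintype.card (Tor (fine n M)) : ℂ)⁻¹ * ∑ x, f x := by
  have hn : (n : ℂ) ≠ 0 := by exact_mod_cast NeZero.ne n
  have hT : (Fintype.card (Tor (fine n M)) : ℂ) ≠ 0 := by exact_mod_cast Fintype.card_ne_zero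
  set μ : ℂ := (Fintype.card (Tor (fine n M)) : ℂ)⁻¹ * ∑ x, f x with hμ
  set g : Tor (fine n M) → ℂ := fun x => f x - μ with hg
  have e : f = g + fun _ => μ := by funext x; simp [hg]
  have horth : ∑ x, g x = 0 := by
    simp only [hg, Finset.sum_sub_distrib, Finset.sum_const, Finset.card_univ, nsmul_eq_mul, hμ]
    field_simp; ring
  rw [e, Matrix.mulVec_add, Pker_orth (fine n M) hn _ horth, zero_add, Pker_mulVec_const]

/-- **`Pker·Q′ᴴ = Q′ᴴ·Cavg`** (the mean of `Q′ᴴω` is `n^{−d}` times the mean of `ω`). [folklore] -/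
theorem Pker_mul_QsOpH : Pker (fine n M) (n : ℂ) * (QsOp n M)ᴴ = (QsOp n M)ᴴ * Cavg M := by
  have hn : ((n : ℂ) ^ d) ≠ 0 := pow_ne_zero _ (by exact_mod_cast NeZero.ne n)
  have hT : (Fintype.card (Tor M) : ℂ) ≠ 0 := by exact_mod_cast Fintype.card_ne_zero
  have hcard : (Fintype.card (Tor (fine n M)) : ℂ) = (n : ℂ) ^ d * Fintype.card (Tor M) := by
    have h := Literature.MathematicalPhysics.QuantumFieldTheory.Balaban1983to89.B5Block118.card_fine n M
    exact_mod_cast h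
  refine ext_of_mulVec_rect fun ω => ?_
  rw [← Matrix.mulVec_mulVec, ← Matrix.mulVec_mulVec, Pker_mulVec_eq, sum_QsOp_adjoint, Cavg_mulVec, QsOp_adjoint_const, hcard]
  funext x
  field_simp

/-- `Δ′1 = a′·1` (`Δ1 = 0`, `Π′1 = 1`). [folklore] -/
theorem DeltaPs_mulVec_const (a : ℂ) : DeltaPs n M a' *ᵥ (fun _ : Tor (fine n M) => a) = fun _ => (a' : ℂ) * a := by
  funext x
  rw [DeltaPs, Matrix.add_mulVec, Matrix.smul_mulVec, Pi.add_apply, Pi.smul_apply, LapS_const, Pi.zero_apply, zero_add,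
    PiS_mulVec, QsOp_const, smul_eq_mul]

variable {a'}

/-- `G′1 = a′⁻¹·1`. [folklore] -/
theorem Gps_mulVec_const (ha' : 0 < a') (a : ℂ) : Gps n M a' *ᵥ (fun _ : Tor (fine n M) => a) = fun _ => ((a' : ℂ))⁻¹ * a := by
  have ha0 : (a' : ℂ) ≠ 0 := by exact_mod_cast ha'.ne'
  have h := DeltaPs_mulVec_const n M a' (((a' : ℂ))⁻¹ * a)
  rw [← mul_assoc, mul_inv_cancel₀ ha0, one_mul] at h
  have h2 := congrArg (fun v => Gps n M a' *ᵥ v) h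
  simp only [Matrix.mulVec_mulVec, Gps_mul_DeltaPs n M ha', Matrix.one_mulVec] at h2
  exact h2.symm

end Tools

/-! ## §2 The `U = 1` resolvent projection `Pone` and the easy inclusion -/

section Pone

variable (n : ℕ) [NeZero n] (M : Fin d → ℕ) [hM : ∀ μ, NeZero (M μ)] (a' : ℝ)

/-- `Kone = Q′G′G′Q′ᴴ` (the unnormalised unit factor; `= n^{−d}·Kcomp`). [folklore] -/
def Kone : Matrix (Tor M) (Tor M) ℂ := QsOp n M * Gps n M a' * Gps n M a' * (QsOp n M)ᴴ

/-- **THE `U = 1` RESOLVENT PROJECTION** `Pone = G′·Q′ᴴ·(Q′G′G′Q′ᴴ)⁻¹·Q′·G′` = the `U = 1` value of `1 − R` of [B9] (3.25)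
(typed; scale-invariant in `Q′`). [folklore] -/
def Pone : Matrix (Tor (fine n M)) (Tor (fine n M)) ℂ :=
  Gps n M a' * (QsOp n M)ᴴ * (Kone n M a')⁻¹ * QsOp n M * Gps n M a'

/-- `Kone = n^{−d}·Kcomp`. [folklore] -/
theorem Kone_eq : Kone n M a' = (((n : ℂ) ^ d))⁻¹ • Kcomp n M a' := by
  have hn : ((n : ℂ) ^ d) ≠ 0 := pow_ne_zero _ (by exact_mod_cast NeZero.ne n)
  rw [Kcomp, smul_smul, inv_mul_cancel₀ hn, one_smul, Kone]

variable {a'}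

/-- `Kone` is invertible. [folklore] -/
theorem isUnit_det_Kone (ha' : 0 < a') : IsUnit (Kone n M a').det := by
  have hn : ((n : ℂ) ^ d) ≠ 0 := pow_ne_zero _ (by exact_mod_cast NeZero.ne n)
  rw [Kone_eq, Matrix.det_smul]
  exact ((isUnit_iff_ne_zero.mpr (inv_ne_zero hn)).pow _).mul (isUnit_det_Kcomp n M ha')

/-- `Pone = G′·Q̃′ᴴ·Kcomp⁻¹·Q̃′·G′` (file 3b's isometric normalisation). [folklore] -/
theorem Pone_eq_iso (ha' : 0 < a') : Pone n M a' = Gps n M a' * (Qiso n M)ᴴ * (Kcomp n M a')⁻¹ * Qiso n M * Gps n M a' := by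
  have hn : ((n : ℂ) ^ d) ≠ 0 := pow_ne_zero _ (by exact_mod_cast NeZero.ne n)
  have hs : star ((((Real.sqrt ((n : ℝ) ^ d)) : ℝ) : ℂ)) = (((Real.sqrt ((n : ℝ) ^ d)) : ℝ) : ℂ) := Complex.conj_ofReal _
  have hss : ((((Real.sqrt ((n : ℝ) ^ d)) : ℝ) : ℂ)) * (((Real.sqrt ((n : ℝ) ^ d)) : ℝ) : ℂ) = (n : ℂ) ^ d := by
    rw [← Complex.ofReal_mul, Real.mul_self_sqrt (pow_nonneg (Nat.cast_nonneg _) d)]; push_cast; rfl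
  have hK : (Kone n M a')⁻¹ = ((n : ℂ) ^ d) • (Kcomp n M a')⁻¹ := by
    refine Matrix.inv_eq_right_inv ?_
    rw [Kone_eq, Matrix.smul_mul, Matrix.mul_smul, smul_smul, inv_mul_cancel₀ hn, one_smul,
      Matrix.mul_nonsing_inv _ (isUnit_det_Kcomp n M ha')]
  rw [Pone, hK, Qiso, Matrix.conjTranspose_smul, hs]
  simp only [Matrix.mul_smul, Matrix.smul_mul, smul_smul]
  rw [hss]

/-- `Pone` is Hermitian. [folklore] -/
theorem Pone_isHermitian : (Pone n M a').IsHermitian := by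
  have hG := Gps_isHermitian n M a'
  have hK : (Kone n M a').IsHermitian := by
    unfold Matrix.IsHermitian Kone
    rw [Matrix.conjTranspose_mul, Matrix.conjTranspose_mul, Matrix.conjTranspose_mul, Matrix.conjTranspose_conjTranspose, hG.eq]
    simp only [Matrix.mul_assoc]
  unfold Matrix.IsHermitian Pone
  rw [Matrix.conjTranspose_mul, Matrix.conjTranspose_mul, Matrix.conjTranspose_mul, Matrix.conjTranspose_mul,
    Matrix.conjTranspose_conjTranspose, hG.eq, Matrix.conjTranspose_nonsing_inv, hK.eq]
  simp only [Matrix.mul_assoc]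

/-- `Pone·(G′Q′ᴴ) = G′Q′ᴴ`. [folklore] -/
theorem Pone_mul_GQ (ha' : 0 < a') : Pone n M a' * (Gps n M a' * (QsOp n M)ᴴ) = Gps n M a' * (QsOp n M)ᴴ := by
  have h : (Kone n M a')⁻¹ * (QsOp n M * Gps n M a' * (Gps n M a' * (QsOp n M)ᴴ)) = 1 := by
    rw [← Matrix.mul_assoc (QsOp n M * Gps n M a'), ← Kone, Matrix.nonsing_inv_mul _ (isUnit_det_Kone n M ha')]
  calc Pone n M a' * (Gps n M a' * (QsOp n M)ᴴ)
      = Gps n M a' * (QsOp n M)ᴴ * ((Kone n M a')⁻¹ * (QsOp n M * Gps n M a' * (Gps n M a' * (QsOp n M)ᴴ))) := by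
        simp only [Pone, Matrix.mul_assoc]
    _ = Gps n M a' * (QsOp n M)ᴴ := by rw [h, Matrix.mul_one]

/-- **the resolvent exchange** `Δ⁻¹Q′ᴴ = G′Q′ᴴ·X`, `X = 1 − Cavg + a′n^d·(Q′Δ⁻¹Q′ᴴ)` (apply `Δ′ = Δ + a′n^dQ′ᴴQ′` to `Δ⁻¹Q′ᴴ`:
`ΔΔ⁻¹ = 1 − Pker`, `PkerQ′ᴴ = Q′ᴴCavg`). [folklore] -/
theorem LapSinv_QsOpH_eq (ha' : 0 < a') :
    LapSinv (fine n M) (n : ℂ) * (QsOp n M)ᴴ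
      = Gps n M a' * (QsOp n M)ᴴ * (1 - Cavg M + ((a' : ℂ) * (n : ℂ) ^ d) • (QsOp n M * LapSinv (fine n M) (n : ℂ) * (QsOp n M)ᴴ)) := by
  set X := (1 - Cavg M + ((a' : ℂ) * (n : ℂ) ^ d) • (QsOp n M * LapSinv (fine n M) (n : ℂ) * (QsOp n M)ᴴ)) with hX
  have key : DeltaPs n M a' * (LapSinv (fine n M) (n : ℂ) * (QsOp n M)ᴴ) = (QsOp n M)ᴴ * X := by
    rw [DeltaPs, Matrix.add_mul, ← Matrix.mul_assoc, LapS_mul_LapSinv, Matrix.sub_mul, Matrix.one_mul, Pker_mul_QsOpH,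
      Matrix.smul_mul, PiS, Matrix.smul_mul, smul_smul, hX, Matrix.mul_add, Matrix.mul_sub, Matrix.mul_one, Matrix.mul_smul]
    simp only [Matrix.mul_assoc]
  calc LapSinv (fine n M) (n : ℂ) * (QsOp n M)ᴴ
      = Gps n M a' * (DeltaPs n M a' * (LapSinv (fine n M) (n : ℂ) * (QsOp n M)ᴴ)) := by
        rw [← Matrix.mul_assoc, Gps_mul_DeltaPs n M ha', Matrix.one_mul]
    _ = Gps n M a' * (QsOp n M)ᴴ * X := by rw [key, Matrix.mul_assoc]

/-- `Pone·Δ⁻¹Q′ᴴ = Δ⁻¹Q′ᴴ`. [folklore] -/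
theorem Pone_mul_LQ (ha' : 0 < a') :
    Pone n M a' * (LapSinv (fine n M) (n : ℂ) * (QsOp n M)ᴴ) = LapSinv (fine n M) (n : ℂ) * (QsOp n M)ᴴ := by
  rw [LapSinv_QsOpH_eq n M ha', ← Matrix.mul_assoc, Pone_mul_GQ n M ha']

/-- **`Pone·PcT = PcT`** (`range PcT ⊂ range Pone`). [folklore] -/
theorem Pone_mul_PcT (ha' : 0 < a') : Pone n M a' * PcT n M (n : ℂ) = PcT n M (n : ℂ) := by
  have h := Pone_mul_LQ n M ha'
  rw [PcT, Pc]
  calc Pone n M a' * (LapSinv (fine n M) (n : ℂ) * (QsOp n M)ᴴ * Minv n M (n : ℂ) * QsOp n M * LapSinv (fine n M) (n : ℂ))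
      = (Pone n M a' * (LapSinv (fine n M) (n : ℂ) * (QsOp n M)ᴴ)) * Minv n M (n : ℂ) * QsOp n M * LapSinv (fine n M) (n : ℂ) := by
        simp only [Matrix.mul_assoc]
    _ = _ := by rw [h]

/-- `Pone 1 = 1`. [folklore] -/
theorem Pone_mulVec_const (ha' : 0 < a') (a : ℂ) : Pone n M a' *ᵥ (fun _ : Tor (fine n M) => a) = fun _ => a := by
  have ha0 : (a' : ℂ) ≠ 0 := by exact_mod_cast ha'.ne'
  have hn : ((n : ℂ) ^ d) ≠ 0 := pow_ne_zero _ (by exact_mod_cast NeZero.ne n)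
  -- `Kone 1 = n^{-d} a′⁻² · 1`, so `Kone⁻¹ 1 = n^d a′² · 1`
  have hK1 : Kone n M a' *ᵥ (fun _ : Tor M => (1 : ℂ)) = fun _ => (((n : ℂ) ^ d))⁻¹ * (((a' : ℂ))⁻¹ * ((a' : ℂ))⁻¹) := by
    rw [Kone, ← Matrix.mulVec_mulVec, ← Matrix.mulVec_mulVec, ← Matrix.mulVec_mulVec, QsOp_adjoint_const, Gps_mulVec_const n M ha',
      Gps_mulVec_const n M ha', QsOp_const]
    funext y; field_simp
  have hKinv : (Kone n M a')⁻¹ *ᵥ (fun _ : Tor M => (1 : ℂ)) = fun _ => ((n : ℂ) ^ d) * ((a' : ℂ) * (a' : ℂ)) := by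
    have h := congrArg (fun v => (Kone n M a')⁻¹ *ᵥ v) hK1
    simp only [Matrix.mulVec_mulVec, Matrix.nonsing_inv_mul _ (isUnit_det_Kone n M ha'), Matrix.one_mulVec] at h
    have e : (fun _ : Tor M => (((n : ℂ) ^ d))⁻¹ * (((a' : ℂ))⁻¹ * ((a' : ℂ))⁻¹))
        = ((((n : ℂ) ^ d))⁻¹ * (((a' : ℂ))⁻¹ * ((a' : ℂ))⁻¹)) • (fun _ : Tor M => (1 : ℂ)) := by
      funext y; simp
    rw [e, Matrix.mulVec_smul] at h
    have h2 := congrArg (fun v => (((n : ℂ) ^ d) * ((a' : ℂ) * (a' : ℂ))) • v) h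
    simp only [smul_smul] at h2
    rw [show ((n : ℂ) ^ d * ((a' : ℂ) * (a' : ℂ))) * ((((n : ℂ) ^ d))⁻¹ * (((a' : ℂ))⁻¹ * ((a' : ℂ))⁻¹)) = 1 by field_simp,
      one_smul] at h2
    rw [← h2]; funext y; simp
  have e1 : (fun _ : Tor (fine n M) => a) = a • (fun _ : Tor (fine n M) => (1 : ℂ)) := by funext x; simp
  rw [e1, Matrix.mulVec_smul]
  congr 1
  rw [Pone, ← Matrix.mulVec_mulVec, ← Matrix.mulVec_mulVec, ← Matrix.mulVec_mulVec, ← Matrix.mulVec_mulVec,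
    Gps_mulVec_const n M ha', QsOp_const, mul_one]
  have e2 : (fun _ : Tor M => ((a' : ℂ))⁻¹) = ((a' : ℂ))⁻¹ • (fun _ : Tor M => (1 : ℂ)) := by funext y; simp
  rw [e2, Matrix.mulVec_smul, hKinv]
  have e3 : ((a' : ℂ))⁻¹ • (fun _ : Tor M => ((n : ℂ) ^ d) * ((a' : ℂ) * (a' : ℂ))) = fun _ : Tor M => ((n : ℂ) ^ d * (a' : ℂ)) := by
    funext y; simp; field_simp
  rw [e3, QsOp_adjoint_const, Gps_mulVec_const n M ha']
  funext x; field_simp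

/-- **`Pone·Pker = Pker`** (constants are in `range Pone`). [folklore] -/
theorem Pone_mul_Pker (ha' : 0 < a') : Pone n M a' * Pker (fine n M) (n : ℂ) = Pker (fine n M) (n : ℂ) := by
  refine ext_of_mulVec fun v => ?_
  rw [← Matrix.mulVec_mulVec, Pker_mulVec_eq, Pone_mulVec_const n M ha']

end Pone

/-! ## §3 The converse inclusion, `Pone = PcT + Pker`, and the gauge term -/

section Converse

variable (n : ℕ) [NeZero n] (M : Fin d → ℕ) [hM : ∀ μ, NeZero (M μ)] {a' : ℝ}

/-- **`(1 − PcT − Pker)·G′Q′ᴴ = 0`** (`range Pone ⊂ range PcT ⊕ constants`). [folklore] -/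
theorem T_mul_GQ_eq_zero (ha' : 0 < a') :
    (1 - PcT n M (n : ℂ) - Pker (fine n M) (n : ℂ)) * (Gps n M a' * (QsOp n M)ᴴ) = 0 := by
  have hn : (n : ℂ) ≠ 0 := by exact_mod_cast NeZero.ne n
  have hG := Gps_isHermitian n M a'
  set T := 1 - PcT n M (n : ℂ) - Pker (fine n M) (n : ℂ) with hT
  -- `T` is an orthogonal projection
  have hTh : Tᴴ = T := by
    rw [hT, Matrix.conjTranspose_sub, Matrix.conjTranspose_sub, Matrix.conjTranspose_one, PcT_conjTranspose, Pker_conjTranspose]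
  have hPL : PcT n M (n : ℂ) * Pker (fine n M) (n : ℂ) = 0 := by
    rw [PcT, Pc, Matrix.mul_assoc, LapSinv_mul_Pker, Matrix.mul_zero]
  have hLP : Pker (fine n M) (n : ℂ) * PcT n M (n : ℂ) = 0 := by
    rw [PcT, Pc]; simp only [← Matrix.mul_assoc]; rw [Pker_mul_LapSinv]; simp
  have hTT : T * T = T := by
    rw [hT, Matrix.sub_mul, Matrix.sub_mul, Matrix.one_mul, Matrix.mul_sub, Matrix.mul_sub, Matrix.mul_one, Matrix.mul_sub,
      Matrix.mul_sub, Matrix.mul_one, PcT_mul_PcT n M (n : ℂ) hn, hPL, hLP, Pker_mul_Pker]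
    abel
  refine ext_of_mulVec_rect fun ω => ?_
  rw [Matrix.zero_mulVec, ← Matrix.mulVec_mulVec]
  set u := (Gps n M a' * (QsOp n M)ᴴ) *ᵥ ω with hu
  set w := T *ᵥ u with hw
  -- (a) `w ⊥ 1`
  have hw_orth : ∑ x, w x = 0 := by
    have h1 : Pker (fine n M) (n : ℂ) *ᵥ w = 0 := by
      rw [hw, Matrix.mulVec_mulVec, hT, Matrix.mul_sub, Matrix.mul_sub, Matrix.mul_one, hLP, Pker_mul_Pker, sub_zero, sub_self,
        Matrix.zero_mulVec]
    have h2 := congrFun h1 (0 : Tor (fine n M))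
    rw [Pker_mulVec_eq, Pi.zero_apply] at h2
    have hT0 : (Fintype.card (Tor (fine n M)) : ℂ)⁻¹ ≠ 0 := inv_ne_zero (by exact_mod_cast Fintype.card_ne_zero)
    exact (mul_eq_zero.mp h2).resolve_left hT0
  -- (b) `Q′Δ⁻¹w = 0`
  have hQLw : QsOp n M *ᵥ (LapSinv (fine n M) (n : ℂ) *ᵥ w) = 0 := by
    have e : w = u - PcT n M (n : ℂ) *ᵥ u - Pker (fine n M) (n : ℂ) *ᵥ u := by
      rw [hw, hT, Matrix.sub_mulVec, Matrix.sub_mulVec, Matrix.one_mulVec]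
    have hP : QsOp n M *ᵥ (LapSinv (fine n M) (n : ℂ) *ᵥ (PcT n M (n : ℂ) *ᵥ u))
        = QsOp n M *ᵥ (LapSinv (fine n M) (n : ℂ) *ᵥ u) := by
      have hM : QsOp n M * LapSinv (fine n M) (n : ℂ) * LapSinv (fine n M) (n : ℂ) * (QsOp n M)ᴴ = Mop n M (n : ℂ) := by
        rw [Mop]; simp only [Matrix.mul_assoc]
      rw [Literature.MathematicalPhysics.QuantumFieldTheory.Balaban1983to89.B5Value126.PcT_mulVec, Matrix.mulVec_mulVec,
        Matrix.mulVec_mulVec, Matrix.mulVec_mulVec, hM, Mop_Minv_of_orth n M (n : ℂ) hn _ (sum_QsOp_LapSinv n M (n : ℂ) u)]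
    have hK : QsOp n M *ᵥ (LapSinv (fine n M) (n : ℂ) *ᵥ (Pker (fine n M) (n : ℂ) *ᵥ u)) = 0 := by
      have e2 : LapSinv (fine n M) (n : ℂ) *ᵥ (Pker (fine n M) (n : ℂ) *ᵥ u) = 0 := by
        rw [Matrix.mulVec_mulVec, LapSinv_mul_Pker, Matrix.zero_mulVec]
      rw [e2, Matrix.mulVec_zero]
    rw [e, Matrix.mulVec_sub, Matrix.mulVec_sub, Matrix.mulVec_sub, Matrix.mulVec_sub, hP, hK, sub_self, zero_sub, neg_zero]
  -- (c) `λ = Δ⁻¹w`: `Δλ = w`, `Π′λ = 0`, `G′Δλ = λ`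
  set lam := LapSinv (fine n M) (n : ℂ) *ᵥ w with hlam
  have hLap : LapS (fine n M) (n : ℂ) *ᵥ lam = w := LapS_LapSinv_of_orth (fine n M) hn w hw_orth
  have hPi : PiS n M *ᵥ lam = 0 := by
    rw [PiS, Matrix.smul_mulVec, ← Matrix.mulVec_mulVec, hQLw, Matrix.mulVec_zero, smul_zero]
  have hGw : Gps n M a' *ᵥ w = lam := by
    have e : w = DeltaPs n M a' *ᵥ lam := by
      rw [DeltaPs, Matrix.add_mulVec, hLap, Matrix.smul_mulVec, hPi, smul_zero, add_zero]
    rw [e, Matrix.mulVec_mulVec, Gps_mul_DeltaPs n M ha', Matrix.one_mulVec]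
  -- (d) `⟨u, w⟩ = ⟨Q′ᴴω, G′w⟩ = ⟨ω, Q′λ⟩ = 0`
  have hQlam : QsOp n M *ᵥ lam = 0 := hQLw
  have huw : star u ⬝ᵥ w = 0 := by
    rw [hu, ← Matrix.mulVec_mulVec, star_mulVec_dotProduct, hG.eq, hGw, star_mulVec_dotProduct, Matrix.conjTranspose_conjTranspose,
      hQlam, dotProduct_zero]
  -- `‖w‖² = ⟨u, T u⟩ = ⟨u, w⟩ = 0`
  have hww : star w ⬝ᵥ w = 0 := by
    have e : star w ⬝ᵥ w = star u ⬝ᵥ ((Tᴴ * T) *ᵥ u) := by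
      rw [hw, ← Matrix.mulVec_mulVec, star_mulVec_dotProduct]
    rw [e, hTh, hTT, ← hw, huw]
  exact dotProduct_star_self_eq_zero.mp hww

/-- `(PcT + Pker)·Pone = Pone`. [folklore] -/
theorem PcTPker_mul_Pone (ha' : 0 < a') :
    (PcT n M (n : ℂ) + Pker (fine n M) (n : ℂ)) * Pone n M a' = Pone n M a' := by
  have h := T_mul_GQ_eq_zero n M ha'
  rw [Matrix.sub_mul, Matrix.sub_mul, Matrix.one_mul, sub_sub, sub_eq_zero] at h
  have h' : (PcT n M (n : ℂ) + Pker (fine n M) (n : ℂ)) * (Gps n M a' * (QsOp n M)ᴴ) = Gps n M a' * (QsOp n M)ᴴ := by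
    rw [Matrix.add_mul]; exact h.symm
  calc (PcT n M (n : ℂ) + Pker (fine n M) (n : ℂ)) * Pone n M a'
      = ((PcT n M (n : ℂ) + Pker (fine n M) (n : ℂ)) * (Gps n M a' * (QsOp n M)ᴴ)) * ((Kone n M a')⁻¹ * QsOp n M * Gps n M a') := by
        simp only [Pone, Matrix.mul_assoc]
    _ = (Gps n M a' * (QsOp n M)ᴴ) * ((Kone n M a')⁻¹ * QsOp n M * Gps n M a') := by rw [h']
    _ = Pone n M a' := by simp only [Pone, Matrix.mul_assoc]

/-- **`Pone = PcT + Pker`**: at `U = 1` the resolvent projection of [B9] (3.25) is B5's (1.70) projection plus the projection onto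
constants. [folklore] -/
theorem Pone_eq (ha' : 0 < a') : Pone n M a' = PcT n M (n : ℂ) + Pker (fine n M) (n : ℂ) := by
  have h1 : Pone n M a' * (PcT n M (n : ℂ) + Pker (fine n M) (n : ℂ)) = PcT n M (n : ℂ) + Pker (fine n M) (n : ℂ) := by
    rw [Matrix.mul_add, Pone_mul_PcT n M ha', Pone_mul_Pker n M ha']
  have h2 := PcTPker_mul_Pone n M ha'
  have hS : (PcT n M (n : ℂ) + Pker (fine n M) (n : ℂ))ᴴ = PcT n M (n : ℂ) + Pker (fine n M) (n : ℂ) := by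
    rw [Matrix.conjTranspose_add, PcT_conjTranspose, Pker_conjTranspose]
  have hP := Pone_isHermitian n M (a' := a')
  calc Pone n M a' = (Pone n M a')ᴴ := hP.eq.symm
    _ = ((PcT n M (n : ℂ) + Pker (fine n M) (n : ℂ)) * Pone n M a')ᴴ := by rw [h2]
    _ = Pone n M a' * (PcT n M (n : ℂ) + Pker (fine n M) (n : ℂ)) := by rw [Matrix.conjTranspose_mul, hS, hP.eq]
    _ = _ := h1

/-- `∂·Pker = 0` (the gradient kills constants). [folklore] -/
theorem GradOp_mul_Pker : GradOp (fine n M) (n : ℂ) * Pker (fine n M) (n : ℂ) = 0 := by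
  refine ext_of_mulVec_rect fun v => ?_
  rw [← Matrix.mulVec_mulVec, Pker_mulVec_eq, Matrix.zero_mulVec]
  funext i
  rw [GradOp_mulVec, sdiff_const, Pi.zero_apply, Pi.zero_apply]

/-- **`∂·Pone·∂ᴴ = ∂·PcT·∂ᴴ`**: the `U = 1` value of tier B's factorised gauge term is the `−∂P∂*` term of `DeltaA = calDa`
([B5] (1.69)/(1.70), `B5DeltaA169.calDa_eq_DeltaA`). [folklore] -/
theorem GradOp_Pone_GradOpH_eq (ha' : 0 < a') :
    GradOp (fine n M) (n : ℂ) * Pone n M a' * (GradOp (fine n M) (n : ℂ))ᴴ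
      = GradOp (fine n M) (n : ℂ) * PcT n M (n : ℂ) * (GradOp (fine n M) (n : ℂ))ᴴ := by
  rw [Pone_eq n M ha', Matrix.mul_add, GradOp_mul_Pker, add_zero]

end Converse

end Summit.QuantumFields.BalabanUV.T4Continuum.ScalarGaugeProjectionUnit

end
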